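import Mathlib
import Summits.QuantumFields.BalabanUV.Beta.AccretiveCombesThomas

/-!
# `Summit.QuantumFields.BalabanUV.Beta.AccretiveCombesThomasBudget` — HOW conjugated coercivity is obtained:
# a Hermitian part costs its cosh (second-order) row defect, an arbitrary remainder costs the mean of its
# exponential (first-order) row ∕ column defects, and the defects are bounded from RANGE or from
# EXPONENTIAL LOCALISATION against a lattice-sum profile

HONEST FRAMING (page 1 of everything in this cell).  Discharging `FlowStep.BetaPertH` would make
Bałaban's ultraviolet stability UNCONDITIONAL — a constructive-QFT result; it is NOT the continuum
limit and NOT the Clay problem.  This module discharges nothing of `BetaPertH`; [folklore] linear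
algebra, kernel-checked (unit `b2b-balaban-beta-d4-p3`, road P3, gen 3; second kernel leaf of the
road's re-cut of NODE A = (T1)(i)(ii) ⇐ (T2) G-IF-10 ⇐ (T3) G-B9-10, census `BETA/REMAINDER-BETA.md` §9).
HONEST DEPENDENCY: continuum YM on T⁴ ⇐ BetaPertH ∧ nine spine estimates (0/9 proved); BetaPertH ⇐
(D1) ∧ (D4) ∧ CAP+tail; G-an2-4 gates asym, D1 and NE2/3/4.

CONTENTS (all PROVED, 0 sorry):
* `expWeight`, `expRowDefect`, `expColDefect` — the first-order pair weight `|e^{κ(ρ_e−ρ_{e′})} − 1|` and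
  its row ∕ column sums against `‖R(e,e′)‖`;
* `conjLower_of_isHermitian` — a HERMITIAN kernel costs its cosh row defect
  (`DeltaACombesThomas.ctRowDefect`; the cosh symmetrisation `DeltaACombesThomas.re_conjugated_form` BY
  NAME, then the AM–GM step re-derived without the coercivity hypothesis of `conjugated_form_coercive`):
  SECOND order in the weight step — the device that makes nearest-neighbour `η⁻²`-entries at
  `ρ`-distance `η` cost `O(δ²)` uniformly in `η` (`Beta.CombesThomasForm` §0);
* `conjLower_of_expDefect` — an ARBITRARY kernel costs `½(J_row + J_col)` (Schur test on the conjugation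
  difference `Σ z̄_e (e^{κΔρ} − 1) R(e,e′) z_{e′}`): FIRST order — adequate for the anti-Hermitian part of a
  complexified background operator, whose entries are `O(α₁η⁻¹)` at `ρ`-distance `η`;
* `expWeight_le_of_abs_sub_le`, `ctWeight_le_of_abs_sub_le` — pair weights from the weight step;
  `exp∕ct…Defect_le_of_range` — kernels of `ρ`-range `≤ r` with row (column) sums `≤ M` cost
  `M(e^{κr} − 1)`; `exp∕ct…Defect_le_of_decay` — kernels with `‖R(e,e′)‖ ≤ θe^{−κ₀d(e,e′)}`, `ρ`
  `d`-Lipschitz, cost `θ·L` against the lattice-sum profile `Σ_{e′} e^{−(κ₀−κ)d(e,e′)} ≤ L` (the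
  «more regular», exponentially localised NON-local terms — e.g. the `Dλ̃(A)`-type terms of B9 (CMP 99)
  (3.183)–(3.184), GAPS G-B9-10, once their own localisation is supplied).

ABSOLUTE RULE.  Nothing printed is cited as a fact; nothing of other lineages is restated (BY NAME:
`DeltaACombesThomas.ctWeight ∕ ctRowDefect ∕ re_conjugated_form`, `B5Prop11Lower.nsq`).  References
(method only): [CombesThomas1973]; Agmon 1982.  NOT summit progress.
-/

open scoped BigOperators Matrix ComplexConjugate
open Finset Complex Matrix

namespace Summit.QuantumFields.BalabanUV.Beta.AccretiveCombesThomasBudget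

open Summit.QuantumFields.BalabanUV.Beta.AccretiveCombesThomas
open Literature.MathematicalPhysics.QuantumFieldTheory.Balaban1983to89.B5Prop11Lower (nsq nsq_nonneg
  norm_star_dotProduct_le)
open Literature.MathematicalPhysics.QuantumFieldTheory.Balaban1983to89.Beta.DeltaACombesThomas
  (ctWeight ctWeight_nonneg ctWeight_symm ctRowDefect ctRowDefect_nonneg re_conjugated_form)

noncomputable section

variable {ι : Type*} [Fintype ι]

/-! ## §1 The first-order weights and defects -/

/-- The exponential (first-order) pair weight `|e^{κ(ρ_e − ρ_{e′})} − 1|`. [folklore] -/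
def expWeight (κ : ℝ) (ρ : ι → ℝ) (e e' : ι) : ℝ := |Real.exp (κ * (ρ e - ρ e')) - 1|

omit [Fintype ι] in
/-- `expWeight ≥ 0`. [folklore] -/
theorem expWeight_nonneg (κ : ℝ) (ρ : ι → ℝ) (e e' : ι) : 0 ≤ expWeight κ ρ e e' := abs_nonneg _

/-- The exponential ROW defect `Σ_{e′} ‖R(e,e′)‖·|e^{κ(ρ_e − ρ_{e′})} − 1|` of an arbitrary kernel. [folklore] -/
def expRowDefect (R : Matrix ι ι ℂ) (κ : ℝ) (ρ : ι → ℝ) (e : ι) : ℝ := ∑ e', ‖R e e'‖ * expWeight κ ρ e e'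

/-- The exponential COLUMN defect `Σ_{e} ‖R(e,e′)‖·|e^{κ(ρ_e − ρ_{e′})} − 1|`. [folklore] -/
def expColDefect (R : Matrix ι ι ℂ) (κ : ℝ) (ρ : ι → ℝ) (e' : ι) : ℝ := ∑ e, ‖R e e'‖ * expWeight κ ρ e e'

/-- Row defects are nonnegative. [folklore] -/
theorem expRowDefect_nonneg (R : Matrix ι ι ℂ) (κ : ℝ) (ρ : ι → ℝ) (e : ι) : 0 ≤ expRowDefect R κ ρ e :=
  Finset.sum_nonneg fun e' _ => mul_nonneg (norm_nonneg _) (expWeight_nonneg κ ρ e e')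

/-- Column defects are nonnegative. [folklore] -/
theorem expColDefect_nonneg (R : Matrix ι ι ℂ) (κ : ℝ) (ρ : ι → ℝ) (e' : ι) : 0 ≤ expColDefect R κ ρ e' :=
  Finset.sum_nonneg fun e _ => mul_nonneg (norm_nonneg _) (expWeight_nonneg κ ρ e e')

/-! ## §2 The Hermitian (cosh) budget and the Schur budget -/

/-- **A Hermitian kernel costs its cosh row defect** (second order in the weight step): the cosh symmetrisation
`DeltaACombesThomas.re_conjugated_form` BY NAME, then AM–GM with the symmetric pair weight (re-derived; cf. the
proof of `DeltaACombesThomas.conjugated_form_coercive`, whose coercivity hypothesis is not needed for the budget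
form). [folklore] -/
theorem conjLower_of_isHermitian (H : Matrix ι ι ℂ) (hH : H.IsHermitian) (κ : ℝ) (ρ : ι → ℝ) {J : ℝ}
    (hJ : ∀ e, ctRowDefect H κ ρ e ≤ J) (z : ι → ℂ) :
    (star z ⬝ᵥ (H *ᵥ z)).re - J * nsq z ≤ (conjForm H κ ρ z).re := by
  have hre : (conjForm H κ ρ z).re
      = ∑ e, ∑ e', ((starRingEnd ℂ) (z e) * H e e' * z e').re * Real.cosh (κ * (ρ e - ρ e')) :=
    re_conjugated_form H hH κ ρ z
  -- split cosh = 1 + (cosh − 1)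
  have hsplit : ∑ e, ∑ e', ((starRingEnd ℂ) (z e) * H e e' * z e').re * Real.cosh (κ * (ρ e - ρ e'))
      = (∑ e, ∑ e', ((starRingEnd ℂ) (z e) * H e e' * z e').re)
        + ∑ e, ∑ e', ((starRingEnd ℂ) (z e) * H e e' * z e').re * ctWeight κ ρ e e' := by
    rw [← Finset.sum_add_distrib]
    refine Finset.sum_congr rfl fun e _ => ?_
    rw [← Finset.sum_add_distrib]
    refine Finset.sum_congr rfl fun e' _ => ?_
    rw [ctWeight]; ring
  have hform : (∑ e, ∑ e', ((starRingEnd ℂ) (z e) * H e e' * z e').re) = (star z ⬝ᵥ (H *ᵥ z)).re := by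
    rw [star_dotProduct_mulVec_eq, Complex.re_sum]
    exact Finset.sum_congr rfl fun e _ => (Complex.re_sum _ _).symm
  -- the defect double sum is ≥ −J‖z‖²
  have h1 : ∀ e e', -(‖z e‖ * ‖H e e'‖ * ‖z e'‖ * ctWeight κ ρ e e')
      ≤ ((starRingEnd ℂ) (z e) * H e e' * z e').re * ctWeight κ ρ e e' := by
    intro e e'
    have hw := ctWeight_nonneg κ ρ e e'
    have hre' : -(‖z e‖ * ‖H e e'‖ * ‖z e'‖) ≤ ((starRingEnd ℂ) (z e) * H e e' * z e').re := by
      have := Complex.abs_re_le_norm ((starRingEnd ℂ) (z e) * H e e' * z e')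
      rw [norm_mul, norm_mul, Complex.norm_conj] at this
      linarith [neg_abs_le ((starRingEnd ℂ) (z e) * H e e' * z e').re]
    nlinarith
  have h2 : ∑ e, ∑ e', ‖z e‖ * ‖H e e'‖ * ‖z e'‖ * ctWeight κ ρ e e'
      ≤ ∑ e, ‖z e‖ ^ 2 * ctRowDefect H κ ρ e := by
    have hamgm : ∑ e, ∑ e', ‖z e‖ * ‖H e e'‖ * ‖z e'‖ * ctWeight κ ρ e e'
        ≤ ∑ e, ∑ e', (‖z e‖ ^ 2 + ‖z e'‖ ^ 2) / 2 * (‖H e e'‖ * ctWeight κ ρ e e') := by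
      refine Finset.sum_le_sum fun e _ => Finset.sum_le_sum fun e' _ => ?_
      have hc : 0 ≤ ‖H e e'‖ * ctWeight κ ρ e e' := mul_nonneg (norm_nonneg _) (ctWeight_nonneg κ ρ e e')
      have : ‖z e‖ * ‖z e'‖ ≤ (‖z e‖ ^ 2 + ‖z e'‖ ^ 2) / 2 := by nlinarith [sq_nonneg (‖z e‖ - ‖z e'‖)]
      calc ‖z e‖ * ‖H e e'‖ * ‖z e'‖ * ctWeight κ ρ e e'
          = (‖z e‖ * ‖z e'‖) * (‖H e e'‖ * ctWeight κ ρ e e') := by ring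
        _ ≤ (‖z e‖ ^ 2 + ‖z e'‖ ^ 2) / 2 * (‖H e e'‖ * ctWeight κ ρ e e') :=
          mul_le_mul_of_nonneg_right this hc
    have hsym : ∑ e, ∑ e', ‖z e'‖ ^ 2 / 2 * (‖H e e'‖ * ctWeight κ ρ e e')
        = ∑ e, ∑ e', ‖z e‖ ^ 2 / 2 * (‖H e e'‖ * ctWeight κ ρ e e') := by
      rw [Finset.sum_comm]
      refine Finset.sum_congr rfl fun e _ => Finset.sum_congr rfl fun e' _ => ?_
      rw [ctWeight_symm κ ρ e' e]
      have hHe : ‖H e' e‖ = ‖H e e'‖ := by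
        rw [← hH.apply e e']; simp
      rw [hHe]
    calc ∑ e, ∑ e', ‖z e‖ * ‖H e e'‖ * ‖z e'‖ * ctWeight κ ρ e e'
        ≤ ∑ e, ∑ e', (‖z e‖ ^ 2 + ‖z e'‖ ^ 2) / 2 * (‖H e e'‖ * ctWeight κ ρ e e') := hamgm
      _ = (∑ e, ∑ e', ‖z e‖ ^ 2 / 2 * (‖H e e'‖ * ctWeight κ ρ e e'))
          + ∑ e, ∑ e', ‖z e'‖ ^ 2 / 2 * (‖H e e'‖ * ctWeight κ ρ e e') := by
        rw [← Finset.sum_add_distrib]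
        refine Finset.sum_congr rfl fun e _ => ?_
        rw [← Finset.sum_add_distrib]
        refine Finset.sum_congr rfl fun e' _ => ?_
        ring
      _ = ∑ e, ‖z e‖ ^ 2 * ctRowDefect H κ ρ e := by
        rw [hsym, ← Finset.sum_add_distrib]
        refine Finset.sum_congr rfl fun e _ => ?_
        rw [ctRowDefect, Finset.mul_sum, ← Finset.sum_add_distrib]
        refine Finset.sum_congr rfl fun e' _ => ?_
        ring
  have h3 : ∑ e, ‖z e‖ ^ 2 * ctRowDefect H κ ρ e ≤ J * nsq z := by
    rw [nsq, Finset.mul_sum]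
    refine Finset.sum_le_sum fun e _ => ?_
    rw [mul_comm]
    exact mul_le_mul_of_nonneg_right (hJ e) (sq_nonneg _)
  have h4 : -(∑ e, ∑ e', ‖z e‖ * ‖H e e'‖ * ‖z e'‖ * ctWeight κ ρ e e')
      ≤ ∑ e, ∑ e', ((starRingEnd ℂ) (z e) * H e e' * z e').re * ctWeight κ ρ e e' := by
    rw [← Finset.sum_neg_distrib]
    refine Finset.sum_le_sum fun e _ => ?_
    rw [← Finset.sum_neg_distrib]
    exact Finset.sum_le_sum fun e' _ => h1 e e'
  rw [hre, hsplit, hform]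
  linarith

/-- The conjugation DIFFERENCE of an arbitrary kernel: `conjForm R − z^*Rz = Σ z̄_e (e^{κ(ρ_e−ρ_{e′})} − 1) R(e,e′) z_{e′}`.
[folklore] -/
theorem conjForm_sub_form (R : Matrix ι ι ℂ) (κ : ℝ) (ρ : ι → ℝ) (z : ι → ℂ) :
    conjForm R κ ρ z - star z ⬝ᵥ (R *ᵥ z)
      = ∑ e, ∑ e', (starRingEnd ℂ) (z e) * (((Real.exp (κ * (ρ e - ρ e')) - 1 : ℝ) : ℂ)) * R e e' * z e' := by
  rw [star_dotProduct_mulVec_eq, conjForm, ← Finset.sum_sub_distrib]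
  refine Finset.sum_congr rfl fun e _ => ?_
  rw [← Finset.sum_sub_distrib]
  refine Finset.sum_congr rfl fun e' _ => ?_
  push_cast
  ring

/-- The conjugation difference is bounded by the weighted absolute double sum. [folklore] -/
theorem norm_conjForm_sub_form_le (R : Matrix ι ι ℂ) (κ : ℝ) (ρ : ι → ℝ) (z : ι → ℂ) :
    ‖conjForm R κ ρ z - star z ⬝ᵥ (R *ᵥ z)‖
      ≤ ∑ e, ∑ e', ‖z e‖ * ‖R e e'‖ * ‖z e'‖ * expWeight κ ρ e e' := by
  rw [conjForm_sub_form]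
  refine (norm_sum_le _ _).trans (Finset.sum_le_sum fun e _ => ?_)
  refine (norm_sum_le _ _).trans (Finset.sum_le_sum fun e' _ => ?_)
  rw [norm_mul, norm_mul, norm_mul, Complex.norm_conj, Complex.norm_real, Real.norm_eq_abs, expWeight]
  ring_nf
  rfl

/-- **An arbitrary kernel costs the mean of its exponential row and column defects** (Schur test on the
conjugation difference; first order in the weight step). [folklore] -/
theorem conjLower_of_expDefect (R : Matrix ι ι ℂ) (κ : ℝ) (ρ : ι → ℝ) {Jr Jc : ℝ}
    (hr : ∀ e, expRowDefect R κ ρ e ≤ Jr) (hc : ∀ e', expColDefect R κ ρ e' ≤ Jc) (z : ι → ℂ) :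
    (star z ⬝ᵥ (R *ᵥ z)).re - (Jr + Jc) / 2 * nsq z ≤ (conjForm R κ ρ z).re := by
  have hD := norm_conjForm_sub_form_le R κ ρ z
  -- AM–GM: the absolute double sum is ≤ ½ Σ_e ‖z_e‖² rowDefect(e) + ½ Σ_{e′} ‖z_{e′}‖² colDefect(e′)
  have hamgm : ∑ e, ∑ e', ‖z e‖ * ‖R e e'‖ * ‖z e'‖ * expWeight κ ρ e e'
      ≤ (∑ e, ‖z e‖ ^ 2 / 2 * expRowDefect R κ ρ e) + ∑ e', ‖z e'‖ ^ 2 / 2 * expColDefect R κ ρ e' := by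
    have h1 : ∑ e, ∑ e', ‖z e‖ * ‖R e e'‖ * ‖z e'‖ * expWeight κ ρ e e'
        ≤ ∑ e, ∑ e', (‖z e‖ ^ 2 / 2 * (‖R e e'‖ * expWeight κ ρ e e')
            + ‖z e'‖ ^ 2 / 2 * (‖R e e'‖ * expWeight κ ρ e e')) := by
      refine Finset.sum_le_sum fun e _ => Finset.sum_le_sum fun e' _ => ?_
      have hw : 0 ≤ ‖R e e'‖ * expWeight κ ρ e e' := mul_nonneg (norm_nonneg _) (expWeight_nonneg κ ρ e e')
      have : ‖z e‖ * ‖z e'‖ ≤ ‖z e‖ ^ 2 / 2 + ‖z e'‖ ^ 2 / 2 := by nlinarith [sq_nonneg (‖z e‖ - ‖z e'‖)]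
      calc ‖z e‖ * ‖R e e'‖ * ‖z e'‖ * expWeight κ ρ e e'
          = (‖z e‖ * ‖z e'‖) * (‖R e e'‖ * expWeight κ ρ e e') := by ring
        _ ≤ (‖z e‖ ^ 2 / 2 + ‖z e'‖ ^ 2 / 2) * (‖R e e'‖ * expWeight κ ρ e e') :=
          mul_le_mul_of_nonneg_right this hw
        _ = _ := by ring
    refine h1.trans (le_of_eq ?_)
    rw [Finset.sum_congr rfl fun e _ => Finset.sum_add_distrib, Finset.sum_add_distrib]
    congr 1
    · refine Finset.sum_congr rfl fun e _ => ?_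
      rw [expRowDefect, Finset.mul_sum]
    · rw [Finset.sum_comm]
      refine Finset.sum_congr rfl fun e' _ => ?_
      rw [expColDefect, Finset.mul_sum]
  have hrow : ∑ e, ‖z e‖ ^ 2 / 2 * expRowDefect R κ ρ e ≤ Jr / 2 * nsq z := by
    rw [nsq, Finset.mul_sum]
    refine Finset.sum_le_sum fun e _ => ?_
    have := hr e
    nlinarith [sq_nonneg ‖z e‖, expRowDefect_nonneg R κ ρ e]
  have hcol : ∑ e', ‖z e'‖ ^ 2 / 2 * expColDefect R κ ρ e' ≤ Jc / 2 * nsq z := by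
    rw [nsq, Finset.mul_sum]
    refine Finset.sum_le_sum fun e' _ => ?_
    have := hc e'
    nlinarith [sq_nonneg ‖z e'‖, expColDefect_nonneg R κ ρ e']
  -- Re conjForm ≥ Re z^*Rz − ‖difference‖
  have hre : (star z ⬝ᵥ (R *ᵥ z)).re - ‖conjForm R κ ρ z - star z ⬝ᵥ (R *ᵥ z)‖ ≤ (conjForm R κ ρ z).re := by
    have h := Complex.abs_re_le_norm (conjForm R κ ρ z - star z ⬝ᵥ (R *ᵥ z))
    rw [Complex.sub_re] at h
    linarith [le_abs_self ((conjForm R κ ρ z).re - (star z ⬝ᵥ (R *ᵥ z)).re),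
      neg_abs_le ((conjForm R κ ρ z).re - (star z ⬝ᵥ (R *ᵥ z)).re)]
  linarith

/-! ## §3 Defect bounds from range and from exponential localisation -/

omit [Fintype ι] in
/-- Pair-weight bound from a bound on the weight step: `|ρ_e − ρ_{e′}| ≤ r`, `κ ≥ 0` ⇒
`|e^{κ(ρ_e − ρ_{e′})} − 1| ≤ e^{κr} − 1`. [folklore] -/
theorem expWeight_le_of_abs_sub_le {κ r : ℝ} (hκ : 0 ≤ κ) {ρ : ι → ℝ} {e e' : ι} (h : |ρ e - ρ e'| ≤ r) :
    expWeight κ ρ e e' ≤ Real.exp (κ * r) - 1 := by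
  have ht : |κ * (ρ e - ρ e')| ≤ κ * r := by
    rw [abs_mul, abs_of_nonneg hκ]; exact mul_le_mul_of_nonneg_left h hκ
  unfold expWeight
  rcases le_or_gt 0 (Real.exp (κ * (ρ e - ρ e')) - 1) with h0 | h0
  · rw [abs_of_nonneg h0]
    linarith [Real.exp_le_exp.2 ((le_abs_self _).trans ht)]
  · rw [abs_of_neg h0]
    have h1 : Real.exp (-(κ * r)) ≤ Real.exp (κ * (ρ e - ρ e')) :=
      Real.exp_le_exp.2 (by linarith [neg_abs_le (κ * (ρ e - ρ e'))])
    have h2 : Real.exp (-(κ * r)) * Real.exp (κ * r) = 1 := by rw [← Real.exp_add, neg_add_cancel, Real.exp_zero]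
    nlinarith [Real.exp_pos (-(κ * r)), Real.exp_pos (κ * r), Real.add_one_le_exp (κ * r),
      mul_nonneg hκ ((abs_nonneg _).trans h)]

omit [Fintype ι] in
/-- The cosh weight is dominated by the exponential weight bound: `cosh t − 1 ≤ e^{|t|} − 1`. [folklore] -/
theorem ctWeight_le_of_abs_sub_le {κ r : ℝ} (hκ : 0 ≤ κ) {ρ : ι → ℝ} {e e' : ι} (h : |ρ e - ρ e'| ≤ r) :
    ctWeight κ ρ e e' ≤ Real.exp (κ * r) - 1 := by
  have ht : |κ * (ρ e - ρ e')| ≤ κ * r := by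
    rw [abs_mul, abs_of_nonneg hκ]; exact mul_le_mul_of_nonneg_left h hκ
  have h1 : Real.exp (κ * (ρ e - ρ e')) ≤ Real.exp (κ * r) := Real.exp_le_exp.2 ((le_abs_self _).trans ht)
  have h2 : Real.exp (-(κ * (ρ e - ρ e'))) ≤ Real.exp (κ * r) :=
    Real.exp_le_exp.2 ((neg_le_abs _).trans ht)
  rw [ctWeight, Real.cosh_eq]
  linarith

/-- **Defect from RANGE**: a kernel of `ρ`-range `≤ r` (entries vanish across weight steps `> r`, `r ≥ 0`) with
row sums `≤ M` has exponential row defect `≤ M(e^{κr} − 1)`. [folklore] -/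
theorem expRowDefect_le_of_range (R : Matrix ι ι ℂ) {κ r M : ℝ} (hκ : 0 ≤ κ) (hr : 0 ≤ r) (ρ : ι → ℝ)
    (hR : ∀ e e', R e e' ≠ 0 → |ρ e - ρ e'| ≤ r) (hM : ∀ e, ∑ e', ‖R e e'‖ ≤ M) (e : ι) :
    expRowDefect R κ ρ e ≤ M * (Real.exp (κ * r) - 1) := by
  have hr1 : 0 ≤ Real.exp (κ * r) - 1 := by
    have : 0 ≤ κ * r := mul_nonneg hκ hr
    linarith [Real.add_one_le_exp (κ * r)]
  calc expRowDefect R κ ρ e = ∑ e', ‖R e e'‖ * expWeight κ ρ e e' := rfl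
    _ ≤ ∑ e', ‖R e e'‖ * (Real.exp (κ * r) - 1) := by
        refine Finset.sum_le_sum fun e' _ => ?_
        by_cases h0 : R e e' = 0
        · simp [h0]
        · exact mul_le_mul_of_nonneg_left (expWeight_le_of_abs_sub_le hκ (hR e e' h0)) (norm_nonneg _)
    _ = (∑ e', ‖R e e'‖) * (Real.exp (κ * r) - 1) := by rw [Finset.sum_mul]
    _ ≤ M * (Real.exp (κ * r) - 1) := mul_le_mul_of_nonneg_right (hM e) hr1

/-- Column version of `expRowDefect_le_of_range` (column sums `≤ M`). [folklore] -/
theorem expColDefect_le_of_range (R : Matrix ι ι ℂ) {κ r M : ℝ} (hκ : 0 ≤ κ) (hr : 0 ≤ r) (ρ : ι → ℝ)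
    (hR : ∀ e e', R e e' ≠ 0 → |ρ e - ρ e'| ≤ r) (hM : ∀ e', ∑ e, ‖R e e'‖ ≤ M) (e' : ι) :
    expColDefect R κ ρ e' ≤ M * (Real.exp (κ * r) - 1) := by
  have hr1 : 0 ≤ Real.exp (κ * r) - 1 := by
    have : 0 ≤ κ * r := mul_nonneg hκ hr
    linarith [Real.add_one_le_exp (κ * r)]
  calc expColDefect R κ ρ e' = ∑ e, ‖R e e'‖ * expWeight κ ρ e e' := rfl
    _ ≤ ∑ e, ‖R e e'‖ * (Real.exp (κ * r) - 1) := by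
        refine Finset.sum_le_sum fun e _ => ?_
        by_cases h0 : R e e' = 0
        · simp [h0]
        · exact mul_le_mul_of_nonneg_left (expWeight_le_of_abs_sub_le hκ (hR e e' h0)) (norm_nonneg _)
    _ = (∑ e, ‖R e e'‖) * (Real.exp (κ * r) - 1) := by rw [Finset.sum_mul]
    _ ≤ M * (Real.exp (κ * r) - 1) := mul_le_mul_of_nonneg_right (hM e') hr1

/-- Cosh version of `expRowDefect_le_of_range` for the Hermitian budget. [folklore] -/
theorem ctRowDefect_le_of_range (H : Matrix ι ι ℂ) {κ r M : ℝ} (hκ : 0 ≤ κ) (hr : 0 ≤ r) (ρ : ι → ℝ)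
    (hH : ∀ e e', H e e' ≠ 0 → |ρ e - ρ e'| ≤ r) (hM : ∀ e, ∑ e', ‖H e e'‖ ≤ M) (e : ι) :
    ctRowDefect H κ ρ e ≤ M * (Real.exp (κ * r) - 1) := by
  have hr1 : 0 ≤ Real.exp (κ * r) - 1 := by
    have : 0 ≤ κ * r := mul_nonneg hκ hr
    linarith [Real.add_one_le_exp (κ * r)]
  calc ctRowDefect H κ ρ e = ∑ e', ‖H e e'‖ * ctWeight κ ρ e e' := rfl
    _ ≤ ∑ e', ‖H e e'‖ * (Real.exp (κ * r) - 1) := by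
        refine Finset.sum_le_sum fun e' _ => ?_
        by_cases h0 : H e e' = 0
        · simp [h0]
        · exact mul_le_mul_of_nonneg_left (ctWeight_le_of_abs_sub_le hκ (hH e e' h0)) (norm_nonneg _)
    _ = (∑ e', ‖H e e'‖) * (Real.exp (κ * r) - 1) := by rw [Finset.sum_mul]
    _ ≤ M * (Real.exp (κ * r) - 1) := mul_le_mul_of_nonneg_right (hM e) hr1

/-- **Defect from EXPONENTIAL LOCALISATION** (the «more regular», NON-local terms): if
`‖R(e,e′)‖ ≤ θe^{−κ₀ d(e,e′)}`, the weight is `d`-Lipschitz (`|ρ_e − ρ_{e′}| ≤ d(e,e′)`), `0 ≤ κ`, and the lattice-sum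
profile `Σ_{e′} e^{−(κ₀−κ)d(e,e′)} ≤ L` holds, then the exponential row defect is `≤ θL`. [folklore] -/
theorem expRowDefect_le_of_decay (R : Matrix ι ι ℂ) {κ κ₀ θ L : ℝ} (hκ : 0 ≤ κ) (hθ : 0 ≤ θ) (ρ : ι → ℝ)
    (d : ι → ι → ℝ) (hρ : ∀ e e', |ρ e - ρ e'| ≤ d e e') (hR : ∀ e e', ‖R e e'‖ ≤ θ * Real.exp (-(κ₀ * d e e')))
    (hL : ∀ e, ∑ e', Real.exp (-((κ₀ - κ) * d e e')) ≤ L) (e : ι) :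
    expRowDefect R κ ρ e ≤ θ * L := by
  calc expRowDefect R κ ρ e = ∑ e', ‖R e e'‖ * expWeight κ ρ e e' := rfl
    _ ≤ ∑ e', θ * Real.exp (-(κ₀ * d e e')) * Real.exp (κ * d e e') := by
        refine Finset.sum_le_sum fun e' _ => ?_
        have hw : expWeight κ ρ e e' ≤ Real.exp (κ * d e e') := by
          have := expWeight_le_of_abs_sub_le hκ (hρ e e')
          linarith
        exact mul_le_mul (hR e e') hw (expWeight_nonneg κ ρ e e')
          (mul_nonneg hθ (Real.exp_pos _).le)
    _ = θ * ∑ e', Real.exp (-((κ₀ - κ) * d e e')) := by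
        rw [Finset.mul_sum]
        refine Finset.sum_congr rfl fun e' _ => ?_
        rw [mul_assoc, ← Real.exp_add]; ring_nf
    _ ≤ θ * L := mul_le_mul_of_nonneg_left (hL e) hθ

/-- Column version of `expRowDefect_le_of_decay` (profile summed over the row index, `d` symmetric not needed:
the hypothesis is stated with `d e e′` as it appears). [folklore] -/
theorem expColDefect_le_of_decay (R : Matrix ι ι ℂ) {κ κ₀ θ L : ℝ} (hκ : 0 ≤ κ) (hθ : 0 ≤ θ) (ρ : ι → ℝ)
    (d : ι → ι → ℝ) (hρ : ∀ e e', |ρ e - ρ e'| ≤ d e e') (hR : ∀ e e', ‖R e e'‖ ≤ θ * Real.exp (-(κ₀ * d e e')))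
    (hL : ∀ e', ∑ e, Real.exp (-((κ₀ - κ) * d e e')) ≤ L) (e' : ι) :
    expColDefect R κ ρ e' ≤ θ * L := by
  calc expColDefect R κ ρ e' = ∑ e, ‖R e e'‖ * expWeight κ ρ e e' := rfl
    _ ≤ ∑ e, θ * Real.exp (-(κ₀ * d e e')) * Real.exp (κ * d e e') := by
        refine Finset.sum_le_sum fun e _ => ?_
        have hw : expWeight κ ρ e e' ≤ Real.exp (κ * d e e') := by
          have := expWeight_le_of_abs_sub_le hκ (hρ e e')
          linarith
        exact mul_le_mul (hR e e') hw (expWeight_nonneg κ ρ e e')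
          (mul_nonneg hθ (Real.exp_pos _).le)
    _ = θ * ∑ e, Real.exp (-((κ₀ - κ) * d e e')) := by
        rw [Finset.mul_sum]
        refine Finset.sum_congr rfl fun e _ => ?_
        rw [mul_assoc, ← Real.exp_add]; ring_nf
    _ ≤ θ * L := mul_le_mul_of_nonneg_left (hL e') hθ

/-- Cosh version of `expRowDefect_le_of_decay` for an exponentially localised HERMITIAN part. [folklore] -/
theorem ctRowDefect_le_of_decay (H : Matrix ι ι ℂ) {κ κ₀ θ L : ℝ} (hκ : 0 ≤ κ) (hθ : 0 ≤ θ) (ρ : ι → ℝ)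
    (d : ι → ι → ℝ) (hρ : ∀ e e', |ρ e - ρ e'| ≤ d e e') (hH : ∀ e e', ‖H e e'‖ ≤ θ * Real.exp (-(κ₀ * d e e')))
    (hL : ∀ e, ∑ e', Real.exp (-((κ₀ - κ) * d e e')) ≤ L) (e : ι) :
    ctRowDefect H κ ρ e ≤ θ * L := by
  calc ctRowDefect H κ ρ e = ∑ e', ‖H e e'‖ * ctWeight κ ρ e e' := rfl
    _ ≤ ∑ e', θ * Real.exp (-(κ₀ * d e e')) * Real.exp (κ * d e e') := by
        refine Finset.sum_le_sum fun e' _ => ?_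
        have hw : ctWeight κ ρ e e' ≤ Real.exp (κ * d e e') := by
          have := ctWeight_le_of_abs_sub_le hκ (hρ e e')
          linarith
        exact mul_le_mul (hH e e') hw (ctWeight_nonneg κ ρ e e')
          (mul_nonneg hθ (Real.exp_pos _).le)
    _ = θ * ∑ e', Real.exp (-((κ₀ - κ) * d e e')) := by
        rw [Finset.mul_sum]
        refine Finset.sum_congr rfl fun e' _ => ?_
        rw [mul_assoc, ← Real.exp_add]; ring_nf
    _ ≤ θ * L := mul_le_mul_of_nonneg_left (hL e) hθ

end

end Summit.QuantumFields.BalabanUV.Beta.AccretiveCombesThomasBudget
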